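import Summits.QuantumFields.BalabanUV.T4Continuum.Support.NE7StraightSliceB5Chart
import Literature.MathematicalPhysics.QuantumFieldTheory.Balaban1983to89.B5Action121
import Summits.QuantumFields.BalabanUV.T4Continuum.Support.NE3SmoothLiftCurl
import HarnessLib

/-!
# NE7StraightSliceB5ChartCurl — row NE7 (node U5), the (A)-bill's XL(c) docking, file D5 (iii) of `t4/b2b-balaban-t4-ne7-p2/g84/XLC-DOCKING-MEMO.md` §7 (first half):
# BAŁABAN's PLAQUETTE FIELD (1.2) `B5Action121.Fs` ∕ `CurlOp` OF THE TRANSFERRED FIELD IS `c ×` THE T4 FLAT CURL READ THROUGH THE CHART; torus sums are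
# period-box sums; the rank-one norm is the entry's modulus

Lineage `b2b-balaban-t4-ne7-p2` (CRUX PROVER NE7 #2, co-owner of row NE7), generation 84 (staged behind (143) `NE7StraightSliceB5Chart`'s olean).  Over (143) (`liftT`, `toB5`,
`read_liftT_add`), lit-balaban's `B5Action121` (`Fs`, `Fs_apply`, `CurlOp_mulVec`; [Balaban1984PropagatorsI] (1.2) p. 18), `NE3SmoothLiftCurl.curlAt_flat_eq`,
`NE3BlockLineAverage.sum_univ_boxVec`.
WHAT ([folklore]): `liftT_unitVec` (`P ≥ 2`); **`Fs_toB5`**: `Fs (fun _ => P) c (toB5 ξ) μ ν x̄ = c · (curlAt 1 ξ (liftT x̄) μ ν)₀₀` for a `P`-periodic rank-one `ξ`; **`CurlOp_mulVec_toB5`**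
(the same through lit-balaban's matrix `CurlOp`); **`sum_tor_liftT`**: `Σ_{x̄ : Tor (P,…,P)} f (liftT x̄) = Σ_{x ∈ periodBox P} f x`; **`norm_fin_one`**: `‖M‖ = ‖M₀₀‖` on `M₁(ℂ)`,
so `dirL1` and sup bounds of rank-one fields are the entrywise `ℓ¹` ∕ sup norms of their transfers; §3 the INVERSE chart `mkT` (class of a site), `liftT_mkT`,
`read_liftT_mkT`, `curlAt_flat_liftT_mkT`, and the inverse transfer **`ofB5`** (`toB5_ofB5`, `ofB5_toB5`, `ofB5_periodic`, `ofB5_skew`: purely imaginary torus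
fields ARE the transfers of skew periodic rank-one fields).  With (143) (`Q_k` = η × straight line mean) this puts the three T4 objects of (142)'s letter `h1src` —
constraint, curl, norms — on lit-balaban's torus in lit-balaban's own symbols; the Hessian ∕ source pairings follow termwise (145).
HONEST FRAMING (page 1): [folklore] index bookkeeping; NO estimate; nothing of Bałaban's asserted beyond the lit-balaban cell's typed (1.2); NOT (APE), NOT ONE-STEP, NOT NE7;
spine 0∕9; finite T⁴ rung (B)+1 — NOT infinite volume, NOT mass gap, NOT Clay.  Continuum YM on T⁴ ⇐ BetaPertH ∧ nine spine estimates (0/9 proved); BetaPertH ⇐ (D1) ∧ (D4) ∧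
CAP+tail; G-an2-4 gates asym, D1 and NE2/3/4.
-/

set_option autoImplicit false

open scoped BigOperators Matrix Matrix.Norms.L2Operator ComplexConjugate
open Finset

namespace Summit.QuantumFields.BalabanUV.T4Continuum.NE7StraightSliceB5ChartCurl

open Literature.MathematicalPhysics.QuantumFieldTheory.Balaban1983to89
open B7Prop1Explicit
open B5Prop11Plancherel (Tor fine unitVec)
open B5Action121 (Fs Fs_apply CurlOp CurlOp_mulVec)
open T4AveragingDeficitWall (curlAt dirL1 IsSkewDir)
open T4AveragingDeficitWallBoundary (periodBox)
open AveragingDeficitPeriodicCounting (IsPeriodicDir)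
open AveragingDeficitTorusChart (periodic_smul_vec)
open BlockAveragePushDirSplit (flat)
open NE3SmoothLiftCurl (curlAt_flat_eq)
open NE3BlockLineAverage (sum_univ_boxVec)
open NE7StraightSliceB5Chart (liftT toB5 toB5_apply liftT_apply liftT_add read_liftT_add)

noncomputable section

variable {d : ℕ}

/-! ## §1 One lattice step through the chart; the plaquette field (1.2) of the transferred field -/

/-- `liftT (e_μ) = e_μ` on `(ℤ∕P)^d` for `P ≥ 2` (`val 1 = 1`). [folklore] -/
theorem liftT_unitVec {P : ℕ} [NeZero P] (hP : 2 ≤ P) (μ : Fin d) : liftT (unitVec (fun _ : Fin d => P) μ) = e μ := by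
  funext ν
  simp only [liftT, unitVec, e]
  by_cases h : ν = μ
  · subst h
    rw [Pi.single_eq_same, Pi.single_eq_same, show (1 : ZMod P) = ((1 : ℕ) : ZMod P) from Nat.cast_one.symm, ZMod.val_cast_of_lt (by omega)]
    rfl
  · rw [Pi.single_eq_of_ne h, Pi.single_eq_of_ne h, ZMod.val_zero]; rfl

/-- A periodic rank-one field read one step away: `toB5 ξ (x̄ + e_μ, ν) = (ξ (liftT x̄ + e_μ) ν)₀₀`. [folklore] -/
theorem toB5_add_unitVec {P : ℕ} [NeZero P] (hP : 2 ≤ P) {ξ : Site d → Fin d → Matrix (Fin 1) (Fin 1) ℂ} (hξ : IsPeriodicDir ξ (P : ℤ))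
    (x : Tor (fun _ : Fin d => P)) (μ ν : Fin d) :
    toB5 ξ (x + unitVec (fun _ : Fin d => P) μ, ν) = ξ (liftT x + e μ) ν 0 0 := by
  rw [toB5_apply, read_liftT_add P (f := fun w => ξ w ν 0 0) (fun y κ => by rw [hξ y κ ν]) x, liftT_unitVec hP]

/-- **BAŁABAN's PLAQUETTE FIELD (1.2) OF THE TRANSFERRED FIELD IS `c ×` THE T4 FLAT CURL THROUGH THE CHART**:
`Fs (P,…,P) c (toB5 ξ) μ ν x̄ = c · (curlAt 1 ξ (liftT x̄) μ ν)₀₀` for a `P`-periodic rank-one `ξ` (`P ≥ 2`). [cite: Balaban1984PropagatorsI, (1.2) p.18] -/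
theorem Fs_toB5 {P : ℕ} [NeZero P] (hP : 2 ≤ P) (c : ℂ) {ξ : Site d → Fin d → Matrix (Fin 1) (Fin 1) ℂ} (hξ : IsPeriodicDir ξ (P : ℤ))
    (μ ν : Fin d) (x : Tor (fun _ : Fin d => P)) :
    Fs (fun _ : Fin d => P) c (toB5 ξ) μ ν x = c * (curlAt (flat (d := d) (n := Fin 1)) ξ (liftT x) μ ν) 0 0 := by
  rw [Fs_apply, toB5_add_unitVec hP hξ, toB5_add_unitVec hP hξ, toB5_apply, toB5_apply, curlAt_flat_eq]
  simp only [Matrix.sub_apply]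
  ring

/-- The same through lit-balaban's matrix `CurlOp`: `(CurlOp c *ᵥ toB5 ξ) (x̄, (μ, ν)) = c · (curlAt 1 ξ (liftT x̄) μ ν)₀₀`. [cite: Balaban1984PropagatorsI, (1.2) p.18] -/
theorem CurlOp_mulVec_toB5 {P : ℕ} [NeZero P] (hP : 2 ≤ P) (c : ℂ) {ξ : Site d → Fin d → Matrix (Fin 1) (Fin 1) ℂ} (hξ : IsPeriodicDir ξ (P : ℤ))
    (x : Tor (fun _ : Fin d => P)) (μ ν : Fin d) :
    (CurlOp (fun _ : Fin d => P) c *ᵥ toB5 ξ) (x, (μ, ν)) = c * (curlAt (flat (d := d) (n := Fin 1)) ξ (liftT x) μ ν) 0 0 := by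
  rw [CurlOp_mulVec, Fs_toB5 hP c hξ]

/-! ## §2 Torus sums are period-box sums; rank-one norms are entry moduli -/

/-- **TORUS SUMS THROUGH THE CHART ARE PERIOD-BOX SUMS**: `Σ_{x̄ : (ℤ∕P)^d} f (liftT x̄) = Σ_{x ∈ periodBox P} f x` (`P ≥ 1`; `ZMod (P′+1) = Fin (P′+1)` and `liftT = boxVec`). [folklore] -/
theorem sum_tor_liftT {β : Type*} [AddCommMonoid β] (P : ℕ) [NeZero P] (f : Site d → β) :
    ∑ x : Tor (fun _ : Fin d => P), f (liftT x) = ∑ x ∈ periodBox (d := d) P, f x := by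
  obtain ⟨P', rfl⟩ := Nat.exists_eq_succ_of_ne_zero (NeZero.ne P)
  exact sum_univ_boxVec (P' + 1) f

/-- The operator norm of a `1×1` complex matrix is the modulus of its entry. [folklore] -/
theorem norm_fin_one (M : Matrix (Fin 1) (Fin 1) ℂ) : ‖M‖ = ‖M 0 0‖ := by
  have hM : M = Matrix.diagonal (fun _ : Fin 1 => M 0 0) := by
    ext i j
    have hi : i = 0 := Subsingleton.elim _ _
    have hj : j = 0 := Subsingleton.elim _ _
    subst hi; subst hj
    rw [Matrix.diagonal_apply_eq]
  rw [hM, Matrix.l2_opNorm_diagonal]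
  exact (pi_norm_const (M 0 0)).trans (by rw [Matrix.diagonal_apply_eq])

/-- **The transfer preserves pointwise norms**: `‖toB5 h (x̄, μ)‖ = ‖h (liftT x̄) μ‖`. [folklore] -/
theorem norm_toB5 {N : Fin d → ℕ} (h : Site d → Fin d → Matrix (Fin 1) (Fin 1) ℂ) (x : Tor N) (μ : Fin d) :
    ‖toB5 h (x, μ)‖ = ‖h (liftT x) μ‖ := by
  rw [toB5_apply, norm_fin_one]

/-- **The `ℓ¹` norm over the period box is the torus `ℓ¹` norm of the transfer** (`P ≥ 1`). [folklore] -/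
theorem dirL1_eq_sum_tor (P : ℕ) [NeZero P] (h : Site d → Fin d → Matrix (Fin 1) (Fin 1) ℂ) :
    dirL1 h (periodBox (d := d) P) = ∑ x : Tor (fun _ : Fin d => P), ∑ μ : Fin d, ‖toB5 h (x, μ)‖ := by
  unfold dirL1
  rw [← sum_tor_liftT P (fun y => ∑ μ : Fin d, ‖h y μ‖)]
  refine Finset.sum_congr rfl fun x _ => Finset.sum_congr rfl fun μ _ => ?_
  rw [norm_toB5]

/-! ## §3 The inverse chart: classes of sites, and the inverse transfer of a torus vector field -/

/-- The class of a site on the isotropic torus `(ℤ∕P)^d`. [folklore] -/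
def mkT (P : ℕ) (x : Site d) : Tor (fun _ : Fin d => P) := fun ν => ((x ν : ℤ) : ZMod P)

/-- unfolding. [folklore] -/
theorem mkT_apply (P : ℕ) (x : Site d) (ν : Fin d) : mkT P x ν = ((x ν : ℤ) : ZMod P) := rfl

/-- `mkT (liftT x̄) = x̄`. [folklore] -/
theorem mkT_liftT (P : ℕ) [NeZero P] (x : Tor (fun _ : Fin d => P)) : mkT P (liftT x) = x := by
  funext ν
  rw [mkT_apply, liftT_apply, Int.cast_natCast, ZMod.natCast_zmod_val]

/-- `mkT (x + P•v) = mkT x`. [folklore] -/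
theorem mkT_add_period (P : ℕ) (x v : Site d) : mkT P (x + (P : ℤ) • v) = mkT P x := by
  funext ν
  rw [mkT_apply, mkT_apply, Pi.add_apply, Pi.smul_apply, smul_eq_mul, Int.cast_add, Int.cast_mul, Int.cast_natCast, ZMod.natCast_self,
    zero_mul, add_zero]

/-- `liftT (mkT x) = x + P•v` with `v_ν = −⌊x_ν ∕ P⌋`. [folklore] -/
theorem liftT_mkT (P : ℕ) [NeZero P] (x : Site d) : liftT (mkT P x) = x + (P : ℤ) • (fun ν => -(x ν / (P : ℤ))) := by
  funext ν
  rw [liftT_apply, mkT_apply, ZMod.val_intCast, Int.emod_def, Pi.add_apply, Pi.smul_apply, smul_eq_mul]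
  ring

/-- **A `P`-periodic function is read at a site through the class of the site.** [folklore] -/
theorem read_liftT_mkT {α : Type*} (P : ℕ) [NeZero P] {f : Site d → α} (hf : ∀ (x : Site d) (κ : Fin d), f (x + (P : ℤ) • e κ) = f x)
    (x : Site d) : f (liftT (mkT P x)) = f x := by
  rw [liftT_mkT]
  exact periodic_smul_vec hf x _

/-- The flat curl of a `P`-periodic field, read through the class of a site. [folklore] -/
theorem curlAt_flat_liftT_mkT (P : ℕ) [NeZero P] {ξ : Site d → Fin d → Matrix (Fin 1) (Fin 1) ℂ} (hξ : IsPeriodicDir ξ (P : ℤ))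
    (z : Site d) (μ ν : Fin d) :
    curlAt (flat (d := d) (n := Fin 1)) ξ (liftT (mkT P z)) μ ν = curlAt (flat (d := d) (n := Fin 1)) ξ z μ ν := by
  rw [liftT_mkT, curlAt_flat_eq, curlAt_flat_eq, add_right_comm z _ (e μ), add_right_comm z _ (e ν),
    periodic_smul_vec (f := fun w => ξ w ν) (fun y κ => hξ y κ ν), periodic_smul_vec (f := fun w => ξ w ν) (fun y κ => hξ y κ ν),
    periodic_smul_vec (f := fun w => ξ w μ) (fun y κ => hξ y κ μ), periodic_smul_vec (f := fun w => ξ w μ) (fun y κ => hξ y κ μ)]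

/-- **THE INVERSE TRANSFER**: a vector field on the torus `(ℤ∕P)^d × Fin d` read as a rank-one `P`-periodic bond field on `ℤ^d`. [folklore] -/
def ofB5 {P : ℕ} (β : Tor (fun _ : Fin d => P) × Fin d → ℂ) : Site d → Fin d → Matrix (Fin 1) (Fin 1) ℂ :=
  fun x κ => β (mkT P x, κ) • (1 : Matrix (Fin 1) (Fin 1) ℂ)

/-- the entry of the inverse transfer. [folklore] -/
theorem ofB5_apply00 {P : ℕ} (β : Tor (fun _ : Fin d => P) × Fin d → ℂ) (x : Site d) (κ : Fin d) : ofB5 β x κ 0 0 = β (mkT P x, κ) := by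
  simp only [ofB5, Matrix.smul_apply, Matrix.one_apply_eq, smul_eq_mul, mul_one]

/-- `toB5 ∘ ofB5 = id`. [folklore] -/
theorem toB5_ofB5 {P : ℕ} [NeZero P] (β : Tor (fun _ : Fin d => P) × Fin d → ℂ) : toB5 (ofB5 β) = β := by
  funext p
  obtain ⟨x, κ⟩ := p
  rw [toB5_apply, ofB5_apply00, mkT_liftT]

/-- The inverse transfer is `P`-periodic. [folklore] -/
theorem ofB5_periodic {P : ℕ} (β : Tor (fun _ : Fin d => P) × Fin d → ℂ) : IsPeriodicDir (ofB5 β) (P : ℤ) := by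
  intro x κ μ
  simp only [ofB5]
  rw [mkT_add_period]

/-- The inverse transfer of a purely imaginary vector field is skew. [folklore] -/
theorem ofB5_skew {P : ℕ} {β : Tor (fun _ : Fin d => P) × Fin d → ℂ} (hβ : ∀ p, conj (β p) = -β p) : IsSkewDir (ofB5 β) := by
  intro x κ
  rw [skewAdjoint.mem_iff]
  simp only [ofB5]
  rw [Matrix.star_eq_conjTranspose, Matrix.conjTranspose_smul, Matrix.conjTranspose_one, Complex.star_def, hβ, neg_smul]

/-- `ofB5 ∘ toB5 = id` on `P`-periodic rank-one fields. [folklore] -/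
theorem ofB5_toB5 {P : ℕ} [NeZero P] {ξ : Site d → Fin d → Matrix (Fin 1) (Fin 1) ℂ} (hξ : IsPeriodicDir ξ (P : ℤ)) :
    ofB5 (toB5 (N := fun _ : Fin d => P) ξ) = ξ := by
  funext x κ
  ext i j
  have hi : i = 0 := Subsingleton.elim _ _
  have hj : j = 0 := Subsingleton.elim _ _
  subst hi; subst hj
  rw [ofB5_apply00, toB5_apply, read_liftT_mkT P (f := fun w => ξ w κ 0 0) (fun y κ' => by rw [hξ y κ' κ])]

end

end Summit.QuantumFields.BalabanUV.T4Continuum.NE7StraightSliceB5ChartCurl
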